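import Summits.KontsevichZagierPeriods.Zeta5Search.LaiSweepShard

/-!
# `κ₃` sweep certificate — shard file 054 of 127 (shards 378–384 of 889)

HONEST FRAMING. Systematic search; no irrationality claim unless certified. This file only checks,
by `decide +kernel`, shards 378–384 of the order-cell sweep of the `κ₃` point `(74, 2180, 444; δ74)`
(engine `LaiSweepEngine`, soundness `LaiSweepJump/Free/Eval/Shard/Kappa3`; a shard is `⟨regime, n,
p, q, p', q', Lo, Up⟩`: `n` cells from `p/q` to `p'/q'` with integer rate sums in `[Lo, Up]`, `K =
128`, `D = 2^40`). It draws NO conclusion: only the capstone `LaiKappa3SweepCert`, which needs all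
127 shard files, does. Kernel cost of this file ≈ 560 cells × 0.3 s.
-/

namespace Summit.KontsevichZagierPeriods.Zeta5Search.Sweep

set_option maxHeartbeats 100000000 in
/-- Shard 378: 80 cells of regime B from `69/193` to `80/223`.
[cite: Lai2024BallRivoal, §4 Lemma 4.3] -/
theorem shard378 :
    Shard.check 128 (2^40)
      ⟨true, 80, 69, 193, 80, 223, 19094194198083, 21120198075605⟩ = true := by
  decide +kernel

set_option maxHeartbeats 100000000 in
/-- Shard 379: 80 cells of regime B from `80/223` to `157/436`.
[cite: Lai2024BallRivoal, §4 Lemma 4.3] -/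
theorem shard379 :
    Shard.check 128 (2^40)
      ⟨true, 80, 80, 223, 157, 436, 20830455416606, 23058907855778⟩ = true := by
  decide +kernel

set_option maxHeartbeats 100000000 in
/-- Shard 380: 80 cells of regime B from `157/436` to `56/155`.
[cite: Lai2024BallRivoal, §4 Lemma 4.3] -/
theorem shard380 :
    Shard.check 128 (2^40)
      ⟨true, 80, 157, 436, 56, 155, 18477090050280, 20468814955201⟩ = true := by
  decide +kernel

set_option maxHeartbeats 100000000 in
/-- Shard 381: 80 cells of regime B from `56/155` to `120/331`.
[cite: Lai2024BallRivoal, §4 Lemma 4.3] -/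
theorem shard381 :
    Shard.check 128 (2^40)
      ⟨true, 80, 56, 155, 120, 331, 19179003343200, 21261915517718⟩ = true := by
  decide +kernel

set_option maxHeartbeats 100000000 in
/-- Shard 382: 80 cells of regime B from `120/331` to `131/360`.
[cite: Lai2024BallRivoal, §4 Lemma 4.3] -/
theorem shard382 :
    Shard.check 128 (2^40)
      ⟨true, 80, 120, 331, 131, 360, 20690492676300, 22957466663733⟩ = true := by
  decide +kernel

set_option maxHeartbeats 100000000 in
/-- Shard 383: 80 cells of regime B from `131/360` to `142/389`.
[cite: Lai2024BallRivoal, §4 Lemma 4.3] -/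
theorem shard383 :
    Shard.check 128 (2^40)
      ⟨true, 80, 131, 360, 142, 389, 17580697756217, 19519616575458⟩ = true := by
  decide +kernel

set_option maxHeartbeats 100000000 in
/-- Shard 384: 80 cells of regime B from `142/389` to `100/273`.
[cite: Lai2024BallRivoal, §4 Lemma 4.3] -/
theorem shard384 :
    Shard.check 128 (2^40)
      ⟨true, 80, 142, 389, 100, 273, 19229040560786, 21365563244717⟩ = true := by
  decide +kernel

/-- The checked shards of this file, in order. [folklore] -/
def shards054 : List (CheckedShard 128 (2^40)) :=
  [⟨_, shard378⟩, ⟨_, shard379⟩, ⟨_, shard380⟩, ⟨_, shard381⟩, ⟨_, shard382⟩,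
    ⟨_, shard383⟩, ⟨_, shard384⟩]

end Summit.KontsevichZagierPeriods.Zeta5Search.Sweep
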